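/-
Copyright (c) 2026 the pub-hodgecm-mathlib formalisation cell (harness21).  Prover seat hodgecm-mathlib-K2Liu-p09 (g6): Track B «K2-LIT»,
hLiu418 = stmt-HodgeConjecture-24832; LEAD F0P6-plan RULING M-158d «A7-val road (σ)», file V8e (the face at rank 2 with the (A4′-R)∕V1c∕modulus∕V6 plugs discharged).
-/
import Summits.HodgeConjecture.HodgeConjecture.Theorems.K2LiuA7ValueFace                 -- ★ V8d p860105 (`face_of_laws`, `exists_average`; brings ★ V8a–c, V1∕V1d, V5, V2b∕V2c, V6a)
import Summits.HodgeConjecture.HodgeConjecture.Theorems.K2LiuA7NormalisedRegularityCM    -- ★ B8-CM `exists_adaptedFrame` (brings ★ B7 `normalisedRegularity`)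
import Summits.HodgeConjecture.HodgeConjecture.Theorems.K2LiuSiegelIntertwiningIntegrable  -- ★ V1c `integrable_weylDelta_mul`
import Summits.HodgeConjecture.HodgeConjecture.Theorems.K2LiuUnipDeltaConjugationModulus   -- ★ `map_conj_unipDeltaLocal_eq_smul` (the modulus `hmod`)
import Summits.HodgeConjecture.HodgeConjecture.Theorems.K2LiuA7NormalisedRegularitySetup   -- ★ `volume_inter_ne_zero`
import HarnessLib

/-!
# Crux `HLiu418`, road `K2_Liu`, organ A7-val, file V8e: THE (A4″-KR) FACE AT RANK `n = 2` FROM THE MODEL LAWS — (A4′-R), INTEGRABILITY, MODULUS, `K′`-AVERAGE DISCHARGED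

Cell `hodgecm-mathlib`, crux item hLiu418 = `stmt-HodgeConjecture-24832`; squad K2 ∕ K2Liu; prover K2Liu-p09 (g6), organ lead A7-val.  THEOREMS ONLY; lane
`--supports stmt-HodgeConjecture-24832` (count-neutral helper).  Generic D10 currency `F E c … v`, `n = 2` (the curve case `H_v = U(2,2)`), every finite place,
model-generic (`ω`, `𝒜`, `B`, `ρ`, Levi∕unipotent pins by value — ★ β-1∕β-2∕A2c∕A2d∕(A4-avg)∕(L2) pay them at the instance of record).
* **`face_two_of_laws`** — the body of `FaceA4doublePrimeKR` (p03 scratch e56f811bc64cfc2c; `K′ : Subgroup`, `𝒜 = f^Δ`, `B = f^{Δ,S} ∘ r_v` abstract) in its exact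
  quantifier shape `∀ (_hχ) (K₀) (_hK₀) (_hIw₀) (K′) (_hK′) (_hIw), ∃ cv ≠ 0, ∀ Φ, K′-invariant → ∀ h f, … → ∃ Fn, regular ∧ factorisation ∧ Fn(½) = cv · B Φ h`,
  with the four analytic plugs DISCHARGED BY NAME: (A4′-R) = ★ B7 `normalisedRegularity` on the adapted frame of ★ B8-CM `exists_adaptedFrame`; the half-plane
  integrability = ★ V1c `integrable_weylDelta_mul`; `aNorm ≠ 0` = ★ V1 `aNorm_two_ne_zero` + ★ `volume_inter_ne_zero`; the modulus = ★ `map_conj_unipDeltaLocal_eq_smul`;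
  and the `K′`-average `B̄` BUILT from the Haar data of `G = U(V′_v)` by 📤 V8d `exists_average` (★ V6a).  What remains by value: the model laws, the `(P′, Δ_{P′})`-law
  and continuity of `B`'s coefficients (V6-inst), the null-cone geometry (V5-inst ← ★ V3), and the two witnesses (V7, V6 (iv)).
HONEST LABEL.  `HC_CM` is proved only modulo the 7 printed citations (2 remaining named inputs: hLiu418 = `stmt-HodgeConjecture-24832`,
h413 = `stmt-HodgeConjecture-24833`) until rung 0 closes.

## References
* [KudlaSweet1997] S. Kudla, W. J. Sweet, Israel J. Math. 98 (1997), §1, Thm. 1.2.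
* [GanQiuTakeda2014] W. T. Gan, Y. Qiu, S. Takeda, Invent. Math. 198 (2014), §2.7–2.8, §5.5 Prop. 11.
* [HarrisKudlaSweet1996] M. Harris, S. Kudla, W. J. Sweet, J. AMS 9 (1996), §1 (1.15), §6 (6.14)–(6.16).
-/

set_option autoImplicit false
set_option linter.dupNamespace false -- the mandated namespace repeats `HodgeConjecture.HodgeConjecture`

noncomputable section

open scoped Classical NNReal ENNReal
open NumberField IsDedekindDomain MeasureTheory MeasureTheory.Measure Topology Set
open Literature.NumberTheory.GaloisRepresentations Literature.NumberTheory.GaloisRepresentations.IsNonarchimedeanLocalField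
open Literature.NumberTheory.Automorphic Literature.NumberTheory.Automorphic.UnitaryGroup
open Literature.NumberTheory.GelbartRogawski1991.UnitaryDualPair.LocalSplitting
open Literature.NumberTheory.K2Lit.LocalSiegelDoubled
open Literature.RepresentationTheory.HeisenbergGroup
open Summit.HodgeConjecture.HodgeConjecture.Cruxes.HLiu418.K2LiuQRationalDefs
open Summit.HodgeConjecture.HodgeConjecture.Cruxes.HLiu418.K2LiuLocalLFactorDefs
open Summit.HodgeConjecture.HodgeConjecture.Cruxes.HLiu418.K2LiuLocalSiegel
open Summit.HodgeConjecture.HodgeConjecture.Cruxes.HLiu418.K2LiuLocalIntertwiningProperty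
open Summit.HodgeConjecture.HodgeConjecture.Cruxes.HLiu418.K2LiuA7ValueFunctional
open Summit.HodgeConjecture.HodgeConjecture.Cruxes.HLiu418.K2LiuA7ValueFace
open Summit.HodgeConjecture.HodgeConjecture.Cruxes.HLiu418.K2LiuA7NormalisedRegularity
open Summit.HodgeConjecture.HodgeConjecture.Cruxes.HLiu418.K2LiuA7NormalisedRegularityCM
open Summit.HodgeConjecture.HodgeConjecture.Cruxes.HLiu418.K2LiuA7NormalisedRegularitySetup
open Summit.HodgeConjecture.HodgeConjecture.Cruxes.HLiu418.K2LiuSiegelIntertwiningIntegrable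
open Summit.HodgeConjecture.HodgeConjecture.Cruxes.HLiu418.K2LiuUnipDeltaConjugationModulus

namespace Summit.HodgeConjecture.HodgeConjecture.Cruxes.HLiu418.K2LiuA7ValueFaceTwo


variable (F : Type) [Field F] [NumberField F] (E : Type) [Field E] [NumberField E] [Algebra F E]
  [Algebra.IsQuadraticExtension F E] (c : E ≃ₐ[F] E)
  {δ : E} (hcδ : c δ = -δ) (hδ : δ ≠ 0) {d : F} (hd : δ * δ = algebraMap F E d) (v : HeightOneSpectrum (𝓞 F))
  {T₀ : Matrix (Fin 2) (Fin 2) F} (hT₀ : T₀.IsSymm) (hT₀d : IsUnit T₀.det)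
  {JD : Matrix (Fin (2 + 2)) (Fin (2 + 2)) E} (hJD : JD = (gramD F 2 T₀).map (algebraMap F E))
  (χv : ∀ w : PlacesOver E v, (w.1.adicCompletion E)ˣ →* ℂˣ) (χv' : ∀ w : PlacesOver E v, (w.1.adicCompletion E)ˣ →* ℂˣ)
  (hχ' : ∀ (w w' : PlacesOver E v) (h : c • w.1 = w'.1),
    χv' w = (χv w')⁻¹.comp (Units.map (galAdicCompletionMap (L := E) c h : w.1.adicCompletion E →* w'.1.adicCompletion E)))
  [MeasurableSpace (unipDeltaLocal F E c v 2 (JD := JD))] [BorelSpace (unipDeltaLocal F E c v 2 (JD := JD))]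
  (νN : Measure (unipDeltaLocal F E c v 2 (JD := JD))) [νN.IsHaarMeasure]
  {ιX : Type} [Fintype ιX]
  (ω : UnitaryGroup.localPi E c (2 + 2) JD v → SchwartzBruhat (ιX → v.adicCompletion F) →ₗ[ℂ] SchwartzBruhat (ιX → v.adicCompletion F))
  (𝒜 : SchwartzBruhat (ιX → v.adicCompletion F) →ₗ[ℂ] ↥(localDegPS F E c hcδ hδ hd v 2 hT₀ hJD χv (1 / 2)))
  (h𝒜 : ∀ (u : UnitaryGroup.localPi E c (2 + 2) JD v) (Φ : SchwartzBruhat (ιX → v.adicCompletion F)) (x : UnitaryGroup.localPi E c (2 + 2) JD v),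
    ((𝒜 (ω u Φ) : ↥(localDegPS F E c hcδ hδ hd v 2 hT₀ hJD χv (1 / 2))) : UnitaryGroup.localPi E c (2 + 2) JD v → ℂ) x =
      ((𝒜 Φ : ↥(localDegPS F E c hcδ hδ hd v 2 hT₀ hJD χv (1 / 2))) : UnitaryGroup.localPi E c (2 + 2) JD v → ℂ) (x * u))
  (B : SchwartzBruhat (ιX → v.adicCompletion F) →ₗ[ℂ] (UnitaryGroup.localPi E c (2 + 2) JD v → ℂ))
  (hB : ∀ (u : UnitaryGroup.localPi E c (2 + 2) JD v) (Φ : SchwartzBruhat (ιX → v.adicCompletion F)) (h : UnitaryGroup.localPi E c (2 + 2) JD v),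
    B (ω u Φ) h = B Φ (h * u))
  (hSiegS : ∀ Φ : SchwartzBruhat (ιX → v.adicCompletion F), IsLocalSiegelSection F E c hcδ hδ hd v 2 hT₀ hJD χv' (-(1 / 2)) (B Φ))
  -- `G = U(V′_v)`: unimodular locally compact second countable, acting LINEARLY on `X` through `ρ`, commuting with `ω(H_v)`, fixing the sections; `P′` closed
  {G : Type} [Group G] [TopologicalSpace G] [IsTopologicalGroup G] [TotallyDisconnectedSpace G] [SigmaCompactSpace G] [LocallyCompactSpace G] [T2Space G]
  [SecondCountableTopology G] [MeasurableSpace G] [BorelSpace G]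
  (ρ : G →* ((ιX → v.adicCompletion F) ≃ₗ[v.adicCompletion F] (ιX → v.adicCompletion F)))
  (hρc : ∀ g, Continuous (ρ g)) (hρc' : ∀ g, Continuous (ρ g).symm)
  (h𝒜G : ∀ (g : G) (Φ : SchwartzBruhat (ιX → v.adicCompletion F)) (x : UnitaryGroup.localPi E c (2 + 2) JD v),
    ((𝒜 (leviEquivSB (ρ g) (hρc g) (hρc' g) Φ) : ↥(localDegPS F E c hcδ hδ hd v 2 hT₀ hJD χv (1 / 2))) : UnitaryGroup.localPi E c (2 + 2) JD v → ℂ) x =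
      ((𝒜 Φ : ↥(localDegPS F E c hcδ hδ hd v 2 hT₀ hJD χv (1 / 2))) : UnitaryGroup.localPi E c (2 + 2) JD v → ℂ) x)
  (hωG : ∀ (u : UnitaryGroup.localPi E c (2 + 2) JD v) (g : G) (Φ : SchwartzBruhat (ιX → v.adicCompletion F)),
    ω u (leviEquivSB (ρ g) (hρc g) (hρc' g) Φ) = leviEquivSB (ρ g) (hρc g) (hρc' g) (ω u Φ))
  (P' : Subgroup G) (hP' : IsClosed (P' : Set G)) [LocallyCompactSpace ↥P']
  (μG : Measure G) [μG.IsHaarMeasure] [μG.IsMulRightInvariant] (μP : Measure ↥P') [μP.IsHaarMeasure]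
  (hBP : ∀ (p : ↥P') (Φ : SchwartzBruhat (ιX → v.adicCompletion F)) (h : UnitaryGroup.localPi E c (2 + 2) JD v),
    B (leviEquivSB (ρ (p : G)) (hρc _) (hρc' _) Φ) h = (((modularCharacter p : ℝ≥0) : ℝ) : ℂ) * B Φ h)
  (hBcont : ∀ (Φ : SchwartzBruhat (ιX → v.adicCompletion F)) (h : UnitaryGroup.localPi E c (2 + 2) JD v),
    Continuous fun x : G => B (leviEquivSB (ρ x) (hρc x) (hρc' x) Φ) h)
  -- the Levi pins
  {Γ₁ : Type} [Group Γ₁] [TopologicalSpace Γ₁] [IsTopologicalGroup Γ₁] [TotallyDisconnectedSpace Γ₁] [SigmaCompactSpace Γ₁]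
  (mΔ : Γ₁ →* UnitaryGroup.localPi E c (2 + 2) JD v) (hmΔ : ∀ a, IsSiegelDelta F E c hcδ hδ hd v 2 hT₀ hJD (mΔ a))
  (aX : Γ₁ →* ((ιX → v.adicCompletion F) ≃ₗ[v.adicCompletion F] (ιX → v.adicCompletion F)))
  (haXc : ∀ a, Continuous (aX a)) (haXc' : ∀ a, Continuous (aX a).symm)
  (cM : Γ₁ →* ℂˣ)
  (hM : ∀ (a : Γ₁) (Φ : SchwartzBruhat (ιX → v.adicCompletion F)), ω (mΔ a) Φ = (cM a : ℂ) • leviEquivSB (aX a) (haXc a) (haXc' a) Φ)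
  (haXρ : ∀ (a : Γ₁) (g : G), Commute (aX a) (ρ g))
  (hcont : Continuous fun p : (Γ₁ × G) × (ιX → v.adicCompletion F) => aX p.1.1 (ρ p.1.2 p.2))
  (K₁ : Subgroup Γ₁) (hK₁ : IsCompact (K₁ : Set Γ₁) ∧ IsOpen (K₁ : Set Γ₁))
  (hK₁χ : ∀ a ∈ K₁, (cM a : ℂ) = localSiegelCharacter F E c v 2 χv' (-(1 / 2)) (mΔ a))
  (a₀ : Γ₁) (ha₀ : (cM a₀ : ℂ) ≠ localSiegelCharacter F E c v 2 χv' (-(1 / 2)) (mΔ a₀))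
  -- the unipotent pins and the null-cone geometry
  {ι : Type} [Fintype ι] (nΔ : (ι → v.adicCompletion F) → UnitaryGroup.localPi E c (2 + 2) JD v)
  (hnΔ : ∀ η, nΔ η ∈ unipDeltaLocal F E c v 2 (JD := JD)) (q : (ιX → v.adicCompletion F) → ι → v.adicCompletion F) (hq : Continuous q)
  (ψ : AddChar (v.adicCompletion F) Circle) {m : ℤ} (hm : ψ.HasConductorExp m)
  (hN : ∀ (η : ι → v.adicCompletion F) (Φ : SchwartzBruhat (ιX → v.adicCompletion F)) (x : ιX → v.adicCompletion F),
    ((ω (nΔ η) Φ : SchwartzBruhat (ιX → v.adicCompletion F)) : (ιX → v.adicCompletion F) → ℂ) x =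
      ((ψ (η ⬝ᵥ q x) : Circle) : ℂ) * (Φ : (ιX → v.adicCompletion F) → ℂ) x)
  (hNρ : ∀ (g : G) (x : ιX → v.adicCompletion F), q x = 0 → q (ρ g x) = 0)
  (hNa : ∀ (a : Γ₁) (x : ιX → v.adicCompletion F), q x = 0 → q (aX a x) = 0)
  (htrans : ∀ x y : ιX → v.adicCompletion F, q x = 0 → q y = 0 → x ≠ 0 → y ≠ 0 → ∃ (a : Γ₁) (g : G), aX a (ρ g x) = y)
  -- the witnesses: V7 (for every Iwasawa compact `K₀`, in family currency at `vol = νN(N_Δ ∩ K₀)`) and V6 (iv) (for every compact open `K′`)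
  (hne : ∀ (K₀ : Subgroup (UnitaryGroup.localPi E c (2 + 2) JD v)),
    IsCompact (K₀ : Set (UnitaryGroup.localPi E c (2 + 2) JD v)) ∧ IsOpen (K₀ : Set (UnitaryGroup.localPi E c (2 + 2) JD v)) →
    (∀ x : UnitaryGroup.localPi E c (2 + 2) JD v, ∃ p, IsSiegelDelta F E c hcδ hδ hd v 2 hT₀ hJD p ∧ ∃ k ∈ K₀, x = p * k) →
    ∃ (Φ₀ : SchwartzBruhat (ιX → v.adicCompletion F)) (f Fn : ℂ → UnitaryGroup.localPi E c (2 + 2) JD v → ℂ),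
      (∀ s, IsLocalSiegelSection F E c hcδ hδ hd v 2 hT₀ hJD χv s (f s)) ∧ (∀ s, IsSmooth F E c v 2 (f s)) ∧ (∀ s s' : ℂ, ∀ k ∈ K₀, f s k = f s' k) ∧
      f (1 / 2) = ((𝒜 Φ₀ : ↥(localDegPS F E c hcδ hδ hd v 2 hT₀ hJD χv (1 / 2))) : UnitaryGroup.localPi E c (2 + 2) JD v → ℂ) ∧
      (∀ h, IsQRationalRegularAt (residueFieldCard (v.adicCompletion F)) (1 / 2) fun s => Fn s h) ∧
      (∀ s : ℂ, 1 < s.re → ∀ h, localIntertwining F E c v 2 hJD νN (f s) h =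
        aNorm F E c v 2 χv (νN.real {u | (u : UnitaryGroup.localPi E c (2 + 2) JD v) ∈ K₀}) s * Fn s h) ∧ Fn (1 / 2) 1 ≠ 0)
  (hBne : ∀ K' : Subgroup G, IsCompact (K' : Set G) ∧ IsOpen (K' : Set G) →
    ∃ Φ₁ : SchwartzBruhat (ιX → v.adicCompletion F), (∀ k ∈ K', leviOp (ρ k) (Φ₁ : (ιX → v.adicCompletion F) → ℂ) = Φ₁) ∧ B Φ₁ 1 ≠ 0)

include hcδ hδ hd hT₀ hT₀d hJD hχ' h𝒜 hB hSiegS h𝒜G hωG hP' hBP hBcont hmΔ hM haXρ hcont hK₁ hK₁χ ha₀ hnΔ hq hm hN hNρ hNa htrans hne hBne μG μP in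
/-- **THE (A4″-KR) FACE AT `n = 2` FROM THE MODEL LAWS**, in the exact quantifier shape of `FaceA4doublePrimeKR` (`K′ : Subgroup`; `𝒜 = f^Δ`, `B = f^{Δ,S} ∘ r_v`
abstract): for unitary `χ_v`, every Iwasawa compact `K₀ ≤ H_v` and every compact open `K′ ≤ G` with `G = P′K′` there is `cv ≠ 0` such that for every `K′`-invariant
`Φ`, every `h` and every `K₀`-flat family `f` of smooth Siegel sections through `𝒜 Φ`: `∃ Fn`, `q_v`-rational and regular at `½`, `M_v(s)(f s) h = aNorm(s) · Fn s` on
`1 < re s`, and `Fn(½) = cv · B Φ h`.  Plugs: ★ B7, ★ B8-CM, ★ V1c, ★ V1 `aNorm_two_ne_zero`, ★ `volume_inter_ne_zero`, ★ `map_conj_unipDeltaLocal_eq_smul`, 📤 V8d.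
[cite: KudlaSweet1997, §1, Thm. 1.2] [cite: GanQiuTakeda2014, §2.7–2.8, §5.5 Prop. 11] [cite: HarrisKudlaSweet1996, §6 (6.14)–(6.16)] -/
theorem face_two_of_laws :
    ∀ (_hχ : ∀ (w' : PlacesOver E v) (x : (w'.1.adicCompletion E)ˣ), ‖((χv w' x : ℂˣ) : ℂ)‖ = 1)
      (K₀ : Subgroup (UnitaryGroup.localPi E c (2 + 2) JD v))
      (_hK₀ : IsCompact (K₀ : Set (UnitaryGroup.localPi E c (2 + 2) JD v)) ∧ IsOpen (K₀ : Set (UnitaryGroup.localPi E c (2 + 2) JD v)))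
      (_hIw₀ : ∀ x : UnitaryGroup.localPi E c (2 + 2) JD v, ∃ p, IsSiegelDelta F E c hcδ hδ hd v 2 hT₀ hJD p ∧ ∃ k ∈ K₀, x = p * k)
      (K' : Subgroup G) (_hK' : IsCompact (K' : Set G) ∧ IsOpen (K' : Set G)) (_hIw : ∀ g : G, ∃ p ∈ P', ∃ k ∈ K', g = p * k),
    ∃ cv : ℂ, cv ≠ 0 ∧ ∀ Φ : SchwartzBruhat (ιX → v.adicCompletion F),
      (∀ k ∈ K', leviOp (ρ k) (Φ : (ιX → v.adicCompletion F) → ℂ) = Φ) →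
      ∀ (h : UnitaryGroup.localPi E c (2 + 2) JD v) (f : ℂ → UnitaryGroup.localPi E c (2 + 2) JD v → ℂ),
        (∀ s, IsLocalSiegelSection F E c hcδ hδ hd v 2 hT₀ hJD χv s (f s)) → (∀ s, IsSmooth F E c v 2 (f s)) →
        (∀ s s' : ℂ, ∀ k ∈ K₀, f s k = f s' k) →
        f (1 / 2) = ((𝒜 Φ : ↥(localDegPS F E c hcδ hδ hd v 2 hT₀ hJD χv (1 / 2))) : UnitaryGroup.localPi E c (2 + 2) JD v → ℂ) →
        ∃ Fn : ℂ → ℂ, IsQRationalRegularAt (residueFieldCard (v.adicCompletion F)) (1 / 2) Fn ∧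
          (∀ s : ℂ, 1 < s.re → localIntertwining F E c v 2 hJD νN (f s) h =
            aNorm F E c v 2 χv (νN.real {u | (u : UnitaryGroup.localPi E c (2 + 2) JD v) ∈ K₀}) s * Fn s) ∧
          Fn (1 / 2) = cv * B Φ h := by
  intro hχ K₀ hK₀ hIw₀ K' hK' hIw
  -- the (A4′-R) plug on the adapted frame, the integrability plug, `aNorm ≠ 0`, the modulus
  obtain ⟨D, Dinv, Q, hDD, hDD', hQm, hQ⟩ := exists_adaptedFrame F 2 hT₀ hT₀d
  have hA4R : ∀ f' : ℂ → UnitaryGroup.localPi E c (2 + 2) JD v → ℂ, (∀ s, IsLocalSiegelSection F E c hcδ hδ hd v 2 hT₀ hJD χv s (f' s)) →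
      (∀ s, IsSmooth F E c v 2 (f' s)) → (∀ s s' : ℂ, ∀ k ∈ K₀, f' s k = f' s' k) →
      ∃ Fn' : ℂ → UnitaryGroup.localPi E c (2 + 2) JD v → ℂ, (∀ h, IsQRationalRegularAt (residueFieldCard (v.adicCompletion F)) (1 / 2) fun s => Fn' s h) ∧
        ∀ s : ℂ, 1 < s.re → ∀ h, localIntertwining F E c v 2 hJD νN (f' s) h =
          aNorm F E c v 2 χv (νN.real {u | (u : UnitaryGroup.localPi E c (2 + 2) JD v) ∈ K₀}) s * Fn' s h := fun f' hS hsm hfl =>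
    normalisedRegularity F E c hcδ hδ hd v hT₀ hJD D Dinv hDD hDD' Q hQm hQ νN χv hχ K₀ hK₀ hIw₀ f' hS hsm hfl
  have hintA : ∀ f' : ℂ → UnitaryGroup.localPi E c (2 + 2) JD v → ℂ, (∀ s, IsLocalSiegelSection F E c hcδ hδ hd v 2 hT₀ hJD χv s (f' s)) →
      (∀ s, IsSmooth F E c v 2 (f' s)) → (∀ s s' : ℂ, ∀ k ∈ K₀, f' s k = f' s' k) → ∀ s : ℂ, 1 < s.re → ∀ h,
      Integrable (fun u : unipDeltaLocal F E c v 2 (JD := JD) => f' s (weylDelta F E c v 2 hJD * (u : UnitaryGroup.localPi E c (2 + 2) JD v) * h)) νN :=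
    fun f' hS hsm _ s hs h => integrable_weylDelta_mul F E c hcδ hδ hd v hT₀ hJD hT₀d νN hχ hs (hS s) (hsm s) h
  have haN : ∀ s : ℂ, 1 < s.re → aNorm F E c v 2 χv (νN.real {u | (u : UnitaryGroup.localPi E c (2 + 2) JD v) ∈ K₀}) s ≠ 0 := fun s hs =>
    aNorm_two_ne_zero F E c v hχ (volume_inter_ne_zero F E c v 2 νN K₀ hK₀) hs
  have hmod : ∀ (q' : UnitaryGroup.localPi E c (2 + 2) JD v) (hq : IsSiegelDelta F E c hcδ hδ hd v 2 hT₀ hJD q'),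
      Measure.map (fun u : unipDeltaLocal F E c v 2 (JD := JD) =>
        (⟨q' * (u : UnitaryGroup.localPi E c (2 + 2) JD v) * q'⁻¹, conj_mem_unipDeltaLocal F E c hcδ hδ hd v 2 hT₀ hJD hq u.2⟩ :
          unipDeltaLocal F E c v 2 (JD := JD))) νN =
        ENNReal.ofReal ((absDetDelta F E c v 2 q' ^ 2)⁻¹) • νN := fun q' hq =>
    map_conj_unipDeltaLocal_eq_smul F E c hcδ hδ hd v 2 hT₀ hT₀d hJD νN hq
  -- the `K′`-average plug (Haar probability-type measure on the compact open `K′`)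
  haveI : CompactSpace ↥K' := isCompact_iff_compactSpace.1 hK'.1
  obtain ⟨Bbar, cK, hcK, hfix, hG, hlaw⟩ :=
    exists_average ρ hρc hρc' P' hP' K' hK' hIw μG μP (Measure.haar : Measure ↥K') B hBP hBcont
  exact face_of_laws F E c hcδ hδ hd v 2 hT₀ hJD χv χv' νN _ haN K₀ hK₀ hIw₀ hA4R hintA hmod hχ' hT₀d ω 𝒜 h𝒜 B hB hSiegS ρ hρc hρc' h𝒜G hωG
    K' hK' Bbar hcK hfix hG hlaw mΔ hmΔ aX haXc haXc' cM hM haXρ hcont K₁ hK₁ hK₁χ a₀ ha₀ nΔ hnΔ q hq ψ hm hN hNρ hNa htrans (hne K₀ hK₀ hIw₀) (hBne K' hK')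

end Summit.HodgeConjecture.HodgeConjecture.Cruxes.HLiu418.K2LiuA7ValueFaceTwo

end
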